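import Summits.QuantumAdvantage.QuantumAdvantage.Theorems.LinnikCubicClassGroupsDegreeOnePrimesEscapeDivisionMainTerm
import Summits.QuantumAdvantage.QuantumAdvantage.Theorems.LinnikCubicClassGroupsDegreeOnePrimesEscapeDivisionThresholds
import HarnessLib

/-!
# The Chebotarev–Linnik theorem for Frobenius DIVISIONS: every Galois number field, every element

Topic `Summits/QuantumAdvantage/QuantumAdvantage/Theorems`, cell B2b-1 (linnik-cubic), PART A (gen 9);
helper toward the crux `DegreeOnePrimesEscape` (stmt-QuantumAdvantage-11543) of route
`LinnikCubicClassGroups`.  HONEST FRAMING: the value of this file is a THEOREM (kernel-checked, GRH-free,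
Siegel-free, no hypothesis) — NOT summit progress.

**Theorem** (`exists_frobenius_generates_le`).  For every `n > 1` there is `L = L(n) > 0` such that for
every Galois number field `N/ℚ` of degree `n` and every `σ ∈ Gal(N/ℚ)` there is a prime `p ≤ |d_N|^L`,
`p ∤ d_N`, having a prime `Q ∣ p` of `N` with trivial inertia and an arithmetic Frobenius `φ` at `Q` such
that `⟨g φ g⁻¹⟩ = ⟨σ⟩` for some `g` — i.e. the Frobenius class of `p` lies in the DIVISION of `σ`
(Frobenius 1896).  This is Lagarias–Montgomery–Odlyzko's theorem [LagariasMontgomeryOdlyzko1979, Thm. 1.1]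
restricted to divisions (unions of the classes of the generators of a cyclic subgroup), with an
inexplicit degree-dependent exponent; it covers every conjugacy class all of whose generators are
conjugate — e.g. EVERY class of `S_n` — including the two-sided classes (3-cycles of `S₃`, `S₄`, 5-cycles of
`S₅`, rotations of `D_p`) that the one-sided method of `…OneSidedFrobenius.lean` cannot reach.

**Proof** (Dedekind zeta functions only): `Σ_{d ∣ m} (μ(d)/d) θ¹_{E_d}(x) − n² log|d_N| ≤ n² Σ_{good p ≤ x} log p`
(`division_sum_le`; `E_d = N^{⟨σ^d⟩}`, `m = ord σ`), and the left side at `x = |d_N|^L` is bounded below by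
the subfield prime ideal theorems of `…DivisionTheta.lean`: (A) no exceptional zero of `ζ_N` — main term
`M x`, `M = Σ μ(d)/d ≥ 1/n²` (real zeros of the `ζ_{E_d}` are zeros of `ζ_N`, Aramata–Brauer, hence
harmless); (B) exceptional zero `β₁` — Heilbronn–Stark gives `K₁` of index `2` with
`ζ_{E_d}(β₁) = 0 ↔ ⟨σ^d⟩ ≤ K₁` (`…DivisionZeros.lean`); (B1) `σ ∈ K₁`: all `E_d` carry `β₁`, POINTED
bounds, main term `M (x − x^{β₁}/β₁) ≫ x Q_N^{−2}` (`…DivisionMainTerm.lean`); (B2) `σ ∉ K₁`: exactly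
the even `d` carry `β₁` and `Σ_{d even} μ(d)/d = −M` (`…DivisionNumerics.lean`) makes the main term
`M (x + x^{β₁}/β₁)`.

References: J. C. Lagarias, H. L. Montgomery, A. M. Odlyzko, Invent. Math. 54 (1979) 271–296, Thm. 1.1
[LagariasMontgomeryOdlyzko1979]; G. Frobenius, S.-B. Preuss. Akad. Wiss. (1896) 689–703 [folklore];
H. M. Stark, Invent. Math. 23 (1974) [Stark1974]; J. Thorner, A. Zaman, Algebra Number Theory 13 (2019)
[ThornerZaman2019].
-/

noncomputable section

open scoped NumberField nonZeroDivisors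
open Finset Real Ideal NumberField
open Literature.NumberTheory.NumberFields Literature.NumberTheory.LFunctions
  Literature.NumberTheory.LFunctions.NumberField

namespace Summit.QuantumAdvantage.QuantumAdvantage.Theorems.DegreeOnePrimesEscape

set_option maxHeartbeats 6000000 in
open scoped Classical in
/-- **The Chebotarev–Linnik theorem for Frobenius divisions** (Lagarias–Montgomery–Odlyzko 1979 for
divisions; see the module docstring): for `n > 1` there is `L > 0` such that for every Galois number field
`N` of degree `n` and every `σ ∈ Gal(N/ℚ)` some prime `p ≤ |d_N|^L`, `p ∤ d_N`, has a Frobenius generating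
a conjugate of `⟨σ⟩`.  GRH-free, Siegel-free, no hypothesis. [cite: LagariasMontgomeryOdlyzko1979, Theorem 1.1] -/
theorem exists_frobenius_generates_le (n : ℕ) (hn : 1 < n) :
    ∃ L : ℝ, 0 < L ∧ ∀ (N : Type) [Field N] [NumberField N] [IsGalois ℚ N],
      Module.finrank ℚ N = n → ∀ σ : N ≃ₐ[ℚ] N,
        ∃ p : ℕ, p.Prime ∧ (p : ℝ) ≤ ((NumberField.discr N).natAbs : ℝ) ^ L ∧
          ¬ ((p : ℤ) ∣ NumberField.discr N) ∧
          ∃ (Q : Ideal (𝓞 N)) (_ : Q.IsMaximal) (_ : Q.LiesOver (span {(p : ℤ)})) (φ g : N ≃ₐ[ℚ] N),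
            IsArithFrobAt ℤ φ Q ∧ Q.inertia (N ≃ₐ[ℚ] N) = ⊥ ∧
              Subgroup.zpowers (g * φ * g⁻¹) = Subgroup.zpowers σ := by
  -- constants depending on `n` only
  have hn0 : (0 : ℝ) < n := by exact_mod_cast (lt_trans Nat.zero_lt_one hn)
  have hn1 : (1 : ℝ) ≤ n := by exact_mod_cast hn.le
  set η : ℝ := 1 / (8 * (n : ℝ) ^ 3) with hη
  have hη0 : 0 < η := by positivity
  obtain ⟨AU, hAU1, hU⟩ := chebyshevThetaIdeal_le_uniform_of_le n hη0
  obtain ⟨AD, hAD1, hD⟩ := chebyshevThetaIdeal_lower_dichotomy n hη0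
  obtain ⟨AP, cP, hAP1, hcP, hP⟩ := chebyshevThetaIdeal_pointed_of_le n hη0
  obtain ⟨X₁, hX₁1, hJ⟩ := chebyshevThetaIdeal_sub_degreeOneTheta_le_rpow n
  obtain ⟨x₀, hx₀2, hθQ⟩ := chebyshevTheta_eventually_ge hη0
  obtain ⟨c₀, hc₀, hLP⟩ := exists_exceptionalZero_const n
  obtain ⟨c₁, hc₁, hc₁1, hMT⟩ := exceptional_mainTerm_ge n hn
  set cstar : ℝ := min (min cP c₀) (1 / 4) with hcstar
  have hcstar0 : 0 < cstar := lt_min (lt_min hcP hc₀) (by norm_num)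
  have hcP' : cstar ≤ cP := (min_le_left _ _).trans (min_le_left _ _)
  have hc₀' : cstar ≤ c₀ := (min_le_left _ _).trans (min_le_right _ _)
  have hc4 : cstar ≤ 1 / 4 := min_le_right _ _
  obtain ⟨L₀, hL₀0, hW⟩ := rpow_div_le_of_le_window hcstar0 hη0
  -- the exponent
  set e : ℝ := (1 : ℝ) + n * n with he
  set A : ℝ := max AU (max AD AP) with hA
  have hA1 : 1 ≤ A := le_trans hAU1 (le_max_left _ _)
  set X : ℝ := max (max X₁ x₀) (Real.exp 16) with hX
  have hX1 : 1 ≤ X := le_trans hX₁1 (le_trans (le_max_left _ _) (le_max_left _ _))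
  obtain ⟨L, hLpos, hL1, hL2, hthr⟩ := division_thresholds n hn L₀ hc₁ hc₁1 hX1 hA1
  refine ⟨L, hLpos, fun N _ _ _ hN σ => ?_⟩
  -- sizes
  have hN1 : 1 < Module.finrank ℚ N := by rw [hN]; exact hn
  set d : ℝ := ((NumberField.discr N).natAbs : ℝ) with hd
  have hd3 : (3 : ℝ) ≤ d := three_le_natAbs_discr_real N hN1
  have hd0 : (0 : ℝ) < d := by linarith
  have hd1 : (1 : ℝ) ≤ d := by linarith
  have hlogd0 : 0 < Real.log d := Real.log_pos (by linarith)
  have hlogd : Real.log d ≤ d := (Real.log_le_sub_one_of_pos hd0).trans (by linarith)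
  set x : ℝ := d ^ L with hx
  have hx0 : 0 < x := Real.rpow_pos_of_pos hd0 L
  obtain ⟨hXx, hjunkA, hlogj, hj1, hj2⟩ := hthr d hd3
  have hX₁x : X₁ ≤ x := le_trans (le_trans (le_max_left _ _) (le_max_left _ _)) hXx
  have hx₀x : x₀ ≤ x := le_trans (le_trans (le_max_right _ _) (le_max_left _ _)) hXx
  have he16 : Real.exp 16 ≤ x := le_trans (le_max_right _ _) hXx
  have hx16 : 16 ≤ Real.log x := by
    have := Real.log_le_log (Real.exp_pos 16) he16; rwa [Real.log_exp] at this
  have hx1 : 1 < x := by linarith [Real.add_one_le_exp (16 : ℝ)]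
  -- the subfields `E_t = N^{⟨σ^t⟩}`
  set m : ℕ := orderOf σ with hm
  have hm0 : m ≠ 0 := (orderOf_pos σ).ne'
  have hcardD : ((m.divisors).card : ℝ) ≤ n := by rw [← hN]; exact card_divisors_orderOf_le σ
  have hM : 1 / ((n : ℝ) ^ 2) ≤ ∑ t ∈ m.divisors, (ArithmeticFunction.moebius t : ℝ) / t :=
    sum_moebius_div_ge_inv_sq hN hn σ
  set E : ℕ → IntermediateField ℚ N := fun t => IntermediateField.fixedField (Subgroup.zpowers (σ ^ t))
    with hE
  set T : ℕ → ℝ := fun t => degreeOneTheta (E t) x with hT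
  -- per-subfield facts
  have hfin : ∀ t, Module.finrank ℚ (E t) ≤ n := by
    intro t
    have h2 := Module.finrank_mul_finrank ℚ (E t) N
    rw [hN] at h2
    have hpos : 0 < Module.finrank (E t) N := Module.finrank_pos
    exact le_of_le_of_eq (Nat.le_mul_of_pos_right _ hpos) h2
  have hdeg : ∀ t, Subgroup.zpowers (σ ^ t) ≠ ⊤ → 1 < Module.finrank ℚ (E t) := fun t ht =>
    one_lt_finrank_fixedField_of_ne_top _ ht
  have hQx : ∀ t, Subgroup.zpowers (σ ^ t) ≠ ⊤ → ∀ {a : ℝ}, 1 ≤ a → a ≤ A →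
      ThornerZaman.condQn (E t) ^ a ≤ x := by
    intro t ht a ha haA
    exact condQn_intermediateField_rpow_le hN hn (E t) (hdeg t ht) (by linarith) haA hL1
  have hAU : AU ≤ A := le_max_left _ _
  have hAD : AD ≤ A := le_trans (le_max_left _ _) (le_max_right _ _)
  have hAP : AP ≤ A := le_trans (le_max_right _ _) (le_max_right _ _)
  have hlogdN : ∀ t, Real.log ((NumberField.discr (E t)).natAbs : ℝ) ≤ Real.log d := by
    intro t
    have hdvd := NumberField.discr_dvd_discr (E t) N
    have h1 : (1 : ℝ) ≤ ((NumberField.discr (E t)).natAbs : ℝ) := by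
      have h := Int.one_le_abs (NumberField.discr_ne_zero (E t))
      rw [Int.abs_eq_natAbs] at h; exact_mod_cast h
    exact Real.log_le_log (by linarith) (by
      rw [hd]; exact_mod_cast Nat.le_of_dvd (Int.natAbs_pos.mpr (NumberField.discr_ne_zero N))
        (Int.natAbs_dvd_natAbs.mpr hdvd))
  -- the three analytic bounds per subfield
  have hUp : ∀ t, Subgroup.zpowers (σ ^ t) ≠ ⊤ → T t ≤ (1 + η) * x := fun t ht =>
    (degreeOneTheta_le_chebyshevThetaIdeal _ x).trans (hU (E t) (hdeg t ht) (hfin t) x (hQx t ht hAU1 hAU))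
  have hJt : ∀ t, chebyshevThetaIdeal (E t) x - x ^ (3 / 4 : ℝ) ≤ T t := by
    intro t; have := hJ (E t) (hfin t) x hX₁x; rw [hT]; linarith
  have hTop : ∀ t, Subgroup.zpowers (σ ^ t) = ⊤ → (1 - η) * x - Real.log d ≤ T t := by
    intro t ht
    have h1 := degreeOneTheta_fixedField_ge_of_forall_mem (Subgroup.zpowers (σ ^ t))
      (fun g => by rw [ht]; exact Subgroup.mem_top g) x
    have h2 := hθQ x hx₀x
    rw [hT]; linarith
  -- a real zero outside the window is harmless: `x^β/β ≤ η x`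
  have hout : ∀ β : ℝ, 3 / 4 ≤ β → β ≤ 1 - cstar / (Real.log d + Real.log 4) → x ^ β / β ≤ η * x :=
    fun β hβ hβc => hW d hd3 L hL2 β (by linarith) hβc
  -- the lower bound `(1 − 2η)x ≤ θ_{E_t}(x)` whenever no real zero of `ζ_{E_t}` lies in the window of `N`
  have hLow : ∀ t, Subgroup.zpowers (σ ^ t) ≠ ⊤ →
      (∀ β : ℝ, dedekindZeta₁ (E t) β = 0 → 3 / 4 ≤ β → β < 1 → β ≤ 1 - cstar / (Real.log d + Real.log 4)) →
      (1 - 2 * η) * x ≤ chebyshevThetaIdeal (E t) x := by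
    intro t ht hzero
    rcases hD (E t) (hdeg t ht) (hfin t) with h1 | ⟨β, hζ, hβ34, hβ1, h2⟩
    · have := h1 x (hQx t ht hAD1 hAD); nlinarith
    · have hb := h2 x (hQx t ht hAD1 hAD)
      have hs := hout β hβ34 (hzero β hζ hβ34 hβ1)
      have hη1 : η ≤ 1 := by
        rw [hη, div_le_one (by positivity)]; nlinarith [pow_le_pow_left₀ zero_le_one hn1 3]
      have hprod := mul_le_mul_of_nonneg_left hs (by linarith : 0 ≤ 1 - η)
      have hsq : 0 ≤ η * (η * x) := by positivity
      have e : (1 - η) * (x - x ^ β / β) = (1 - η) * x - (1 - η) * (x ^ β / β) := by ring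
      have e' : (1 - η) * (η * x) = η * x - η * (η * x) := by ring
      linarith
  -- `μ(t) = −1` forces `t > 1`, so `⟨σ^t⟩ ≠ G`
  have hμtop : ∀ t ∈ m.divisors, ArithmeticFunction.moebius t = -1 → Subgroup.zpowers (σ ^ t) ≠ ⊤ := by
    intro t ht hμ
    refine zpowers_pow_ne_top σ (Nat.dvd_of_mem_divisors ht) ?_
    by_contra h; push Not at h
    have : t = 1 := le_antisymm h (Nat.pos_of_mem_divisors ht)
    rw [this, ArithmeticFunction.moebius_apply_one] at hμ; norm_num at hμ
  -- the final arithmetic, shared by the cases with main term `≥ M x`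
  have hconc : ∀ V S : ℝ, (1 / (n : ℝ) ^ 2) * x ≤ V →
      V - (m.divisors.card : ℝ) * (2 * η * x + x ^ (3 / 4 : ℝ) + Real.log d) ≤ S →
      (n : ℝ) ^ 2 * Real.log d < S := by
    intro V S h1 hlow
    have h2 : (m.divisors.card : ℝ) * (2 * η * x + x ^ (3 / 4 : ℝ) + Real.log d) ≤
        n * (2 * η * x + x ^ (3 / 4 : ℝ) + Real.log d) :=
      mul_le_mul_of_nonneg_right hcardD (by positivity)
    have e1 : (n : ℝ) * (2 * η * x) = x / (4 * n ^ 2) := by rw [hη]; field_simp; norm_num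
    have e2 : (1 / (n : ℝ) ^ 2) * x = 4 * (x / (4 * n ^ 2)) := by field_simp
    have hq0 : 0 < x / (4 * (n : ℝ) ^ 2) := by positivity
    linarith [hjunkA, hlogj]
  have hsum := division_sum_le σ x
  rw [hN] at hsum
  -- it suffices that the weighted sum beats `n² log d`
  suffices hpos : (n : ℝ) ^ 2 * Real.log d <
      ∑ t ∈ m.divisors, (ArithmeticFunction.moebius t : ℝ) / t * T t by
    have hS : 0 < ∑ p ∈ (Nat.primesLE ⌊x⌋₊).filter
        (fun p : ℕ => ¬ ((p : ℤ) ∣ NumberField.discr N) ∧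
          ∃ (Q : Ideal (𝓞 N)) (_ : Q.IsMaximal) (_ : Q.LiesOver (span {(p : ℤ)})) (φ g : N ≃ₐ[ℚ] N),
            IsArithFrobAt ℤ φ Q ∧ Q.inertia (N ≃ₐ[ℚ] N) = ⊥ ∧
              Subgroup.zpowers (g * φ * g⁻¹) = Subgroup.zpowers σ), Real.log p := by
      by_contra hle
      push Not at hle
      have : (n : ℝ) ^ 2 * _ ≤ 0 := mul_nonpos_of_nonneg_of_nonpos (by positivity) hle
      have hT' : ∑ t ∈ m.divisors, (ArithmeticFunction.moebius t : ℝ) / t * T t =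
          ∑ t ∈ (orderOf σ).divisors, (ArithmeticFunction.moebius t : ℝ) / t *
            degreeOneTheta (IntermediateField.fixedField (Subgroup.zpowers (σ ^ t))) x := rfl
      linarith
    obtain ⟨p, hp, hpx, hpN, hP⟩ := exists_prime_of_sum_log_pos hS
    exact ⟨p, hp, hpx, hpN, hP⟩
  -- CASE ANALYSIS on the exceptional zero of `ζ_N`
  by_cases hexc : ∃ β₁ : ℝ, dedekindZeta₁ N β₁ = 0 ∧
      1 - cstar / (Real.log d + Real.log 4) < β₁ ∧ β₁ < 1
  swap
  · -- CASE A: no exceptional zero — main term `M x`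
    have hlow := sum_moebius_div_mul_ge_of_termwise m T (fun _ => x)
      (Err := 2 * η * x + x ^ (3 / 4 : ℝ) + Real.log d) (by positivity) ?_ ?_
    · have hmain : ∑ t ∈ m.divisors, (ArithmeticFunction.moebius t : ℝ) / t * x =
          (∑ t ∈ m.divisors, (ArithmeticFunction.moebius t : ℝ) / t) * x := (Finset.sum_mul _ _ _).symm
      rw [hmain] at hlow
      exact hconc _ _ (mul_le_mul_of_nonneg_right hM hx0.le) hlow
    · -- termwise lower bounds (`μ = 1`)
      intro t ht _
      have hx34 : 0 ≤ x ^ (3 / 4 : ℝ) := Real.rpow_nonneg hx0.le _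
      have hl0 : 0 ≤ Real.log d := hlogd0.le
      have hηx : 0 ≤ η * x := by positivity
      by_cases htop : Subgroup.zpowers (σ ^ t) = ⊤
      · have := hTop t htop
        linarith
      · have h1 := hLow t htop (fun β hζ _ hβ1 =>
          subfield_realZero_le_of_no_exceptional hexc (E t) hβ1 hζ)
        have h2 := hJt t
        linarith
    · -- termwise upper bounds (`μ = −1`)
      intro t ht hμ
      have := hUp t (hμtop t ht hμ)
      have hx34 : 0 ≤ x ^ (3 / 4 : ℝ) := Real.rpow_nonneg hx0.le _
      have hl0 : 0 ≤ Real.log d := hlogd0.le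
      have hηx : 0 ≤ η * x := by positivity
      linarith
  · -- CASE B: the exceptional zero `β₁`
    obtain ⟨β₁, hζ₁, hβ₁c, hβ₁1⟩ := hexc
    have hlog4 : 0 < Real.log 4 := Real.log_pos (by norm_num)
    have hβ34 : 3 / 4 ≤ β₁ := by
      have : cstar / (Real.log d + Real.log 4) ≤ 1 / 4 := by
        rw [div_le_iff₀ (by linarith)]
        have hlog4' : 1 < Real.log 4 := by
          rw [show (4:ℝ) = 2 ^ 2 by norm_num, Real.log_pow]; have := Real.log_two_gt_d9; push_cast; linarith
        nlinarith
      linarith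
    have hβ0 : 0 < β₁ := by linarith
    have hβne : (β₁ : ℂ) ≠ 1 := fun h => hβ₁1.ne (by exact_mod_cast h)
    set y : ℝ := x ^ β₁ / β₁ with hy
    have hy0 : 0 ≤ y := div_nonneg (Real.rpow_nonneg hx0.le _) hβ0.le
    -- Heilbronn–Stark
    obtain ⟨K₁, hK₁, hHS⟩ := exists_index_two_of_exceptional hN1 hc4 hζ₁ hβ₁c hβ₁1
    have hK₁top : K₁ ≠ ⊤ := by
      intro h; rw [h, Subgroup.index_top] at hK₁; norm_num at hK₁
    -- the pointed bounds for the subfields carrying `β₁`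
    have hPt : ∀ t, Subgroup.zpowers (σ ^ t) ≤ K₁ →
        0 < x - y ∧ |chebyshevThetaIdeal (E t) x - (x - y)| ≤ η * (x - y) := by
      intro t ht
      have htop : Subgroup.zpowers (σ ^ t) ≠ ⊤ := fun h => hK₁top (top_le_iff.mp (h ▸ ht))
      have hζt : dedekindZeta₁ (E t) β₁ = 0 := (hHS _).mpr ht
      have hwin : 1 - cP / (Real.log ((NumberField.discr (E t)).natAbs : ℝ) + Real.log 4) < β₁ := by
        have hlt : 0 ≤ Real.log ((NumberField.discr (E t)).natAbs : ℝ) := Real.log_natCast_nonneg _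
        have h1 : cstar / (Real.log d + Real.log 4) ≤
            cP / (Real.log ((NumberField.discr (E t)).natAbs : ℝ) + Real.log 4) := by
          rw [div_le_div_iff₀ (by linarith) (by linarith)]
          have := hlogdN t
          nlinarith [hcstar0, hcP]
        linarith
      exact hP (E t) (hdeg t htop) (hfin t) β₁ hζt hβ0 hβ₁1 hwin x (hQx t htop hAP1 hAP)
    by_cases hσK : σ ∈ K₁
    · -- CASE B1: `σ ∈ K₁` — every `E_t` carries `β₁`; main term `M (x − y) ≫ x Q_N^{−2}`
      have hall : ∀ t, Subgroup.zpowers (σ ^ t) ≤ K₁ := fun t =>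
        Subgroup.zpowers_le.mpr (K₁.pow_mem hσK t)
      have hxy : 0 < x - y := (hPt 1 (hall 1)).1
      have hlow := sum_moebius_div_mul_ge_of_termwise m T (fun _ => x - y)
        (Err := η * (x - y) + x ^ (3 / 4 : ℝ)) (by positivity) ?_ ?_
      · have hmain : ∑ t ∈ m.divisors, (ArithmeticFunction.moebius t : ℝ) / t * (x - y) =
            (∑ t ∈ m.divisors, (ArithmeticFunction.moebius t : ℝ) / t) * (x - y) := (Finset.sum_mul _ _ _).symm
        rw [hmain] at hlow
        -- `x − y ≥ W = x c₁ / (4 d^{2e})` (Stark), and the junk is `≤ W/(4n²)`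
        set W : ℝ := x * c₁ / (4 * d ^ (2 * e)) with hWdef
        have hWxy : W ≤ x - y := hMT N hN β₁ hζ₁ hβ34 hβ₁1 x hx1 hx16
        have hW0 : 0 < W := by positivity
        have h1 : (1 / (n : ℝ) ^ 2) * (x - y) ≤ (∑ t ∈ m.divisors, (ArithmeticFunction.moebius t : ℝ) / t) * (x - y) :=
          mul_le_mul_of_nonneg_right hM hxy.le
        have h2 : (m.divisors.card : ℝ) * (η * (x - y) + x ^ (3 / 4 : ℝ)) ≤ n * (η * (x - y) + x ^ (3 / 4 : ℝ)) :=
          mul_le_mul_of_nonneg_right hcardD (by positivity)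
        have e1 : (n : ℝ) * (η * (x - y)) = (x - y) / (8 * n ^ 2) := by rw [hη]; field_simp
        have e2 : (1 / (n : ℝ) ^ 2) * (x - y) = 8 * ((x - y) / (8 * n ^ 2)) := by field_simp
        have e3 : W / (4 * n ^ 2) = 2 * (W / (8 * n ^ 2)) := by field_simp; ring
        have h4 : W / (8 * (n : ℝ) ^ 2) ≤ (x - y) / (8 * n ^ 2) :=
          div_le_div_of_nonneg_right hWxy (by positivity)
        have hw0 : 0 < W / (8 * (n : ℝ) ^ 2) := by positivity
        linarith
      · intro t ht _
        obtain ⟨-, hb⟩ := hPt t (hall t)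
        have := (abs_le.mp hb).1
        have h2 := hJt t
        linarith
      · intro t ht _
        obtain ⟨-, hb⟩ := hPt t (hall t)
        have := (abs_le.mp hb).2
        have h2 := degreeOneTheta_le_chebyshevThetaIdeal (E t) x
        have hTt : T t = degreeOneTheta (E t) x := rfl
        have hx34 : 0 ≤ x ^ (3 / 4 : ℝ) := Real.rpow_nonneg hx0.le _
        linarith
    · -- CASE B2: `σ ∉ K₁` — `E_t` carries `β₁` iff `t` is even; main term `M (x + y) ≥ M x`
      have hcarry : ∀ t, Subgroup.zpowers (σ ^ t) ≤ K₁ ↔ Even t := fun t => by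
        rw [Subgroup.zpowers_le, pow_mem_iff_even_of_index_two hK₁ hσK]
      have hmeven : 2 ∣ m := by
        have : σ ^ m ∈ K₁ := by rw [hm, pow_orderOf_eq_one]; exact K₁.one_mem
        exact even_iff_two_dvd.mp ((pow_mem_iff_even_of_index_two hK₁ hσK m).mp this)
      have hlow := sum_moebius_div_mul_ge_of_termwise m T (fun t => x - (if Even t then 1 else 0) * y)
        (Err := 2 * η * x + x ^ (3 / 4 : ℝ) + Real.log d) (by positivity) ?_ ?_
      · have hmain : ∑ t ∈ m.divisors, (ArithmeticFunction.moebius t : ℝ) / t * (x - (if Even t then 1 else 0) * y) =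
            (∑ t ∈ m.divisors, (ArithmeticFunction.moebius t : ℝ) / t) * (x + y) := by
          have hsplit : ∀ t ∈ m.divisors, (ArithmeticFunction.moebius t : ℝ) / t * (x - (if Even t then 1 else 0) * y) =
              (ArithmeticFunction.moebius t : ℝ) / t * x -
                (ArithmeticFunction.moebius t : ℝ) / t * (if Even t then 1 else 0) * y := fun t _ => by ring
          rw [Finset.sum_congr rfl hsplit, Finset.sum_sub_distrib, ← Finset.sum_mul, ← Finset.sum_mul,
            sum_moebius_div_ite_even_eq_neg m hmeven hm0]
          ring
        rw [hmain] at hlow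
        have hM0 : (0 : ℝ) ≤ ∑ t ∈ m.divisors, (ArithmeticFunction.moebius t : ℝ) / t :=
          le_trans (by positivity) hM
        refine hconc _ _ ?_ hlow
        calc (1 / (n : ℝ) ^ 2) * x ≤ (∑ t ∈ m.divisors, (ArithmeticFunction.moebius t : ℝ) / t) * x :=
              mul_le_mul_of_nonneg_right hM hx0.le
          _ ≤ (∑ t ∈ m.divisors, (ArithmeticFunction.moebius t : ℝ) / t) * (x + y) :=
              mul_le_mul_of_nonneg_left (by linarith) hM0
      · -- termwise lower bounds (`μ = 1`)
        intro t ht _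
        have hx34 : 0 ≤ x ^ (3 / 4 : ℝ) := Real.rpow_nonneg hx0.le _
        have hl0 : 0 ≤ Real.log d := hlogd0.le
        have hηx : 0 ≤ η * x := by positivity
        by_cases htop : Subgroup.zpowers (σ ^ t) = ⊤
        · have := hTop t htop
          have hεy : 0 ≤ (if Even t then (1 : ℝ) else 0) * y := by positivity
          linarith
        · have h2 := hJt t
          by_cases hev : Even t
          · rw [if_pos hev, one_mul]
            obtain ⟨hxy, hb⟩ := hPt t ((hcarry t).mpr hev)
            have := (abs_le.mp hb).1
            have hηxy : η * (x - y) ≤ η * x := mul_le_mul_of_nonneg_left (by linarith) hη0.le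
            linarith
          · rw [if_neg hev, zero_mul, sub_zero]
            have hne : dedekindZeta₁ (E t) β₁ ≠ 0 := fun h =>
              hev ((hcarry t).mp ((hHS _).mp h))
            have h1 := hLow t htop (fun β hζ _ hβ1 =>
              subfield_realZero_le_of_ne hN hc₀' hLP hζ₁ hβ₁c (E t) hne hβ1 hζ)
            linarith
      · -- termwise upper bounds (`μ = −1`)
        intro t ht hμ
        have htop := hμtop t ht hμ
        have hx34 : 0 ≤ x ^ (3 / 4 : ℝ) := Real.rpow_nonneg hx0.le _
        have hl0 : 0 ≤ Real.log d := hlogd0.le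
        have hηx : 0 ≤ η * x := by positivity
        have hTt : T t = degreeOneTheta (E t) x := rfl
        by_cases hev : Even t
        · rw [if_pos hev, one_mul]
          obtain ⟨hxy, hb⟩ := hPt t ((hcarry t).mpr hev)
          have := (abs_le.mp hb).2
          have h2 := degreeOneTheta_le_chebyshevThetaIdeal (E t) x
          have hηxy : η * (x - y) ≤ η * x := mul_le_mul_of_nonneg_left (by linarith) hη0.le
          linarith
        · rw [if_neg hev, zero_mul, sub_zero]
          have := hUp t htop
          linarith

end Summit.QuantumAdvantage.QuantumAdvantage.Theorems.DegreeOnePrimesEscape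

end
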